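import Summits.CriticalPhenomena.PercolationContinuityZ3.Theorems.PercNearOneGluingNoHeavyLowerTailKNGoodHair
import Summits.CriticalPhenomena.PercolationContinuityZ3.Theorems.PercNearOneGluingNoHeavyLowerTailKNConjOneTwoStarsTools
import HarnessLib

/-!
# The series step for Kozma–Nitzan GOODNESS — tools I: affinity in a pair at the observer, the isolated observer
# (`NoHeavyLowerTail` cell, stmt-CriticalPhenomena-4575; prover `prim-hp-2`, deletion–contraction line, gen 3)

Support file (`--supports stmt-CriticalPhenomena-4575`).  No definitions, no named facts, no sorries.
Notation (written out in full below, never abbreviated by a `def`): for a weight function `u`, observer `v`, relay `a`, sink `b`,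
`agood(u, v; a) := P_u(v ↔ b) − P_u(a ↔ b) + Σ_{W ∩ A = ∅} P_u(C(v) = W) · min_{a′} P_u(a′ ↔ b off W)` — Kozma–Nitzan's goodness
inequality for `(G_u, A, v, b)` with the witness `a` made explicit (`KNGood u A v b ⟺ agood(u, v; argmin) ≥ 0`).
`w⁰ = pinW w {pairs at o} ∅` is `G − o` (pairs at `o` closed).

* `KNGoodSeries.agood_affine_pair` — for a pair `e = s(v,q)` AT the observer, `u ↦ agood(w[e↦u], v; a)` is affine:
  `agood(w[e↦u]) = (1−u)·agood(w[e↦0]) + u·agood(w[e↦1])` (the minima `min P(· ↔ b off W)`, `W ∋ v`, do not feel `e`).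
* `KNGoodSeries.real_openConnIn_erase_wzero` — under `w⁰`, avoiding `W` and avoiding `W ∖ {o}` are the same (`o` is isolated);
  `KNGoodSeries.real_openConnIn_compl_singleton_wzero` — `P_{w⁰}(a ↔ b off o) = P_{w⁰}(a ↔ b)`.
* `KNGoodSeries.agood_wzero_observer` — **corner (0,0)**: `agood(w⁰, o; a) = min_{a′} P_{w⁰}(a′ ↔ b) − P_{w⁰}(a ↔ b)`.
-/

noncomputable section

namespace Summit.CriticalPhenomena.PercolationContinuityZ3.Theorems

open MeasureTheory Set Literature.Probability.LatticeModels Literature.Probability.Percolation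
open scoped Classical BigOperators

variable {n : ℕ}

namespace KNGoodSeries

open ChampionStability KNGoodAux KNGoodHair RelayNbhd CILTwoSteiner

/-- **Affinity of the goodness functional in a pair at the observer.**  For `q ≠ v`, any `a, b`, and `e = s(v,q)`:
`agood(w[e↦u], v; a) = (1 − u)·agood(w[e↦0], v; a) + u·agood(w[e↦1], v; a)`. [folklore] -/
theorem agood_affine_pair (w : Sym2 (Fin n) → unitInterval) (A : Finset (Fin n)) (hA : A.Nonempty)
    (v q a b : Fin n) (u : unitInterval) :
    (prodBernoulli (Function.update w s(v, q) u)).real (openConn v b) -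
        (prodBernoulli (Function.update w s(v, q) u)).real (openConn a b) +
        ∑ W ∈ nullSets A, (prodBernoulli (Function.update w s(v, q) u)).real (clusterIs v W) *
          A.inf' hA (fun a' => (prodBernoulli (Function.update w s(v, q) u)).real (openConnIn ((↑W : Set (Fin n))ᶜ) a' b)) =
      (1 - (u : ℝ)) * ((prodBernoulli (Function.update w s(v, q) 0)).real (openConn v b) -
        (prodBernoulli (Function.update w s(v, q) 0)).real (openConn a b) +
        ∑ W ∈ nullSets A, (prodBernoulli (Function.update w s(v, q) 0)).real (clusterIs v W) *
          A.inf' hA (fun a' => (prodBernoulli (Function.update w s(v, q) 0)).real (openConnIn ((↑W : Set (Fin n))ᶜ) a' b))) +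
      (u : ℝ) * ((prodBernoulli (Function.update w s(v, q) 1)).real (openConn v b) -
        (prodBernoulli (Function.update w s(v, q) 1)).real (openConn a b) +
        ∑ W ∈ nullSets A, (prodBernoulli (Function.update w s(v, q) 1)).real (clusterIs v W) *
          A.inf' hA (fun a' => (prodBernoulli (Function.update w s(v, q) 1)).real (openConnIn ((↑W : Set (Fin n))ᶜ) a' b))) := by
  set μ0 := prodBernoulli (Function.update w s(v, q) 0) with hμ0
  set μ1 := prodBernoulli (Function.update w s(v, q) 1) with hμ1
  have hdec : ∀ (u' : unitInterval) (S : Set (BondConfig (Fin n))),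
      (prodBernoulli (Function.update w s(v, q) u')).real S = (1 - (u' : ℝ)) * μ0.real S + (u' : ℝ) * μ1.real S := by
    intro u' S
    have h := stub_oneBondDecomp_k15 n (Function.update w s(v, q) u') s(v, q) S
    rwa [Function.update_idem, Function.update_idem, Function.update_self] at h
  -- the minima do not feel the pair at the observer
  have hinf : ∀ (u' : unitInterval) (W : Finset (Fin n)), v ∈ W →
      A.inf' hA (fun a' => (prodBernoulli (Function.update w s(v, q) u')).real (openConnIn ((↑W : Set (Fin n))ᶜ) a' b)) =
        A.inf' hA (fun a' => μ0.real (openConnIn ((↑W : Set (Fin n))ᶜ) a' b)) := by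
    intro u' W hvW
    refine Finset.inf'_congr hA rfl fun a' _ => ?_
    rw [hμ0]
    exact real_update_eq_of_preimage_insert_eq w s(v, q) _ (preimage_insert_openConnIn_eq W v q a' b hvW) u'
  have hcl0 : ∀ W : Finset (Fin n), v ∉ W → (clusterIs v W : Set (BondConfig (Fin n))) = ∅ := by
    intro W hvW
    ext ω
    simp only [mem_empty_iff_false, iff_false]
    intro hω
    rw [mem_clusterIs] at hω
    have : v ∈ openCluster ω v := mem_openCluster_self ω v
    rw [hω, Finset.mem_coe] at this
    exact hvW this
  have hsum : ∀ u' : unitInterval,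
      ∑ W ∈ nullSets A, (prodBernoulli (Function.update w s(v, q) u')).real (clusterIs v W) *
          A.inf' hA (fun a' => (prodBernoulli (Function.update w s(v, q) u')).real (openConnIn ((↑W : Set (Fin n))ᶜ) a' b)) =
        ∑ W ∈ nullSets A, ((1 - (u' : ℝ)) * μ0.real (clusterIs v W) + (u' : ℝ) * μ1.real (clusterIs v W)) *
          A.inf' hA (fun a' => μ0.real (openConnIn ((↑W : Set (Fin n))ᶜ) a' b)) := by
    intro u'
    refine Finset.sum_congr rfl fun W _ => ?_
    by_cases hvW : v ∈ W
    · rw [hdec u', hinf u' W hvW]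
    · rw [hcl0 W hvW, measureReal_empty, measureReal_empty, measureReal_empty]; ring
  have hsplit : ∀ u' : unitInterval,
      ∑ W ∈ nullSets A, ((1 - (u' : ℝ)) * μ0.real (clusterIs v W) + (u' : ℝ) * μ1.real (clusterIs v W)) *
          A.inf' hA (fun a' => μ0.real (openConnIn ((↑W : Set (Fin n))ᶜ) a' b)) =
        (1 - (u' : ℝ)) * ∑ W ∈ nullSets A, μ0.real (clusterIs v W) *
            A.inf' hA (fun a' => μ0.real (openConnIn ((↑W : Set (Fin n))ᶜ) a' b)) +
          (u' : ℝ) * ∑ W ∈ nullSets A, μ1.real (clusterIs v W) *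
            A.inf' hA (fun a' => μ0.real (openConnIn ((↑W : Set (Fin n))ᶜ) a' b)) := by
    intro u'
    rw [Finset.mul_sum, Finset.mul_sum, ← Finset.sum_add_distrib]
    exact Finset.sum_congr rfl fun W _ => by ring
  rw [hsum u, hsum 0, hsum 1, hsplit u, hsplit 0, hsplit 1, hdec u (openConn v b), hdec u (openConn a b),
    hdec 0 (openConn v b), hdec 0 (openConn a b), hdec 1 (openConn v b), hdec 1 (openConn a b)]
  have h0 : ((0 : unitInterval) : ℝ) = 0 := rfl
  have h1 : ((1 : unitInterval) : ℝ) = 1 := rfl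
  rw [h0, h1]
  ring

/-- Under `w⁰ = G − o` (pairs at `o` closed), for `a ≠ o`: avoiding `W` and avoiding `W ∖ {o}` are the same event up to a null
set (`o` is almost surely isolated). [folklore] -/
theorem real_openConnIn_erase_wzero (w : Sym2 (Fin n) → unitInterval) (o a b : Fin n) (hao : a ≠ o)
    (W : Finset (Fin n)) :
    (prodBernoulli (pinW w {e : Sym2 (Fin n) | o ∈ e ∧ ¬ e.IsDiag} ∅)).real (openConnIn ((↑W : Set (Fin n))ᶜ) a b) =
      (prodBernoulli (pinW w {e : Sym2 (Fin n) | o ∈ e ∧ ¬ e.IsDiag} ∅)).real (openConnIn ((↑(W.erase o) : Set (Fin n))ᶜ) a b) := by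
  haveI : ∀ u : Sym2 (Fin n) → unitInterval, IsProbabilityMeasure (prodBernoulli u) := fun u => inferInstance
  refine measureReal_congr_of_null _ _ _ {ω | ∀ u : Fin n, u ≠ o → s(o, u) ∉ ω} (real_compl_isolated_eq_zero w o) ?_
  ext ω
  simp only [mem_inter_iff, mem_setOf_eq]
  constructor
  · rintro ⟨h, hω⟩
    refine ⟨openConnIn_mono ?_ a b h, hω⟩
    intro z hz
    simp only [mem_compl_iff, Finset.mem_coe, Finset.mem_erase, not_and] at hz ⊢
    exact fun _ => hz
  · rintro ⟨h, hω⟩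
    refine ⟨?_, hω⟩
    -- an open path avoiding `W ∖ {o}` from `a ≠ o` never visits the isolated `o`
    rw [DCT16.mem_openConnIn_iff_pathIn] at h ⊢
    obtain ⟨ha, hpath⟩ := h
    have haW : a ∈ ((↑W : Set (Fin n))ᶜ) := by
      simp only [mem_compl_iff, Finset.mem_coe, Finset.mem_erase] at ha ⊢
      exact fun h => ha ⟨hao, h⟩
    refine ⟨haW, ?_⟩
    induction hpath with
    | refl => exact Relation.ReflTransGen.refl
    | @tail c d _ hcd ih =>
      refine Relation.ReflTransGen.tail ih ⟨hcd.1, ?_⟩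
      have hdo : d ≠ o := by
        intro hd
        have hadj := hcd.1
        rw [openGraph_adj, hd] at hadj
        exact hω c hadj.2 (by rw [Sym2.eq_swap]; exact hadj.1)
      have hd := hcd.2
      simp only [mem_compl_iff, Finset.mem_coe, Finset.mem_erase] at hd ⊢
      exact fun h => hd ⟨hdo, h⟩

/-- Under `w⁰ = G − o`, for `a ≠ o`: `P_{w⁰}(a ↔ b off o) = P_{w⁰}(a ↔ b)`. [folklore] -/
theorem real_openConnIn_compl_singleton_wzero (w : Sym2 (Fin n) → unitInterval) (o a b : Fin n) (hao : a ≠ o) :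
    (prodBernoulli (pinW w {e : Sym2 (Fin n) | o ∈ e ∧ ¬ e.IsDiag} ∅)).real (openConnIn ((↑({o} : Finset (Fin n)) : Set (Fin n))ᶜ) a b) =
      (prodBernoulli (pinW w {e : Sym2 (Fin n) | o ∈ e ∧ ¬ e.IsDiag} ∅)).real (openConn a b) := by
  rw [real_openConnIn_erase_wzero w o a b hao {o}, Finset.erase_singleton]
  congr 1
  ext ω
  rw [Finset.coe_empty, compl_empty]
  constructor
  · exact fun h => KNPreFKG.reachable_of_openConnIn h
  · intro h
    exact openConnIn_of_reachable_of_forall_mem h fun _ _ => mem_univ _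

/-- **Corner (0,0): the isolated observer.**  `o ∉ A`, `b ≠ o`, `a ∈ A`:
`agood(w⁰, o; a) = min_{a′ ∈ A} P_{w⁰}(a′ ↔ b) − P_{w⁰}(a ↔ b)` (under `w⁰` the cluster of `o` is `{o}` and `o ↮ b`). [folklore] -/
theorem agood_wzero_observer (w : Sym2 (Fin n) → unitInterval) (A : Finset (Fin n)) (hA : A.Nonempty) (o a b : Fin n)
    (ho : o ∉ A) (hbo : b ≠ o) :
    (prodBernoulli (pinW w {e : Sym2 (Fin n) | o ∈ e ∧ ¬ e.IsDiag} ∅)).real (openConn o b) -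
        (prodBernoulli (pinW w {e : Sym2 (Fin n) | o ∈ e ∧ ¬ e.IsDiag} ∅)).real (openConn a b) +
        ∑ W ∈ nullSets A, (prodBernoulli (pinW w {e : Sym2 (Fin n) | o ∈ e ∧ ¬ e.IsDiag} ∅)).real (clusterIs o W) *
          A.inf' hA (fun a' => (prodBernoulli (pinW w {e : Sym2 (Fin n) | o ∈ e ∧ ¬ e.IsDiag} ∅)).real
            (openConnIn ((↑W : Set (Fin n))ᶜ) a' b)) =
      A.inf' hA (fun a' => (prodBernoulli (pinW w {e : Sym2 (Fin n) | o ∈ e ∧ ¬ e.IsDiag} ∅)).real (openConn a' b)) -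
        (prodBernoulli (pinW w {e : Sym2 (Fin n) | o ∈ e ∧ ¬ e.IsDiag} ∅)).real (openConn a b) := by
  haveI : ∀ u : Sym2 (Fin n) → unitInterval, IsProbabilityMeasure (prodBernoulli u) := fun u => inferInstance
  set μ0 := prodBernoulli (pinW w {e : Sym2 (Fin n) | o ∈ e ∧ ¬ e.IsDiag} ∅) with hμ0
  set Z : Set (BondConfig (Fin n)) := {ω | ∀ u : Fin n, u ≠ o → s(o, u) ∉ ω} with hZ
  have hZ0 : μ0.real Zᶜ = 0 := real_compl_isolated_eq_zero w o
  -- `P(o ↔ b) = 0`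
  have hob : μ0.real (openConn o b) = 0 := by
    have h : μ0.real (openConn o b) = μ0.real (∅ : Set (BondConfig (Fin n))) := by
      refine measureReal_congr_of_null μ0 _ _ Z hZ0 ?_
      ext ω
      simp only [mem_inter_iff, mem_empty_iff_false, false_and, iff_false, not_and]
      intro h hω
      exact hbo (eq_of_reachable_of_isolated hω h)
    rw [h, measureReal_empty]
  -- the cluster of `o` is `{o}`
  have hcl : ∀ W ∈ nullSets A, W ≠ {o} → μ0.real (clusterIs o W) = 0 := by
    intro W _ hW
    have h : μ0.real (clusterIs o W) = μ0.real (∅ : Set (BondConfig (Fin n))) := by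
      refine measureReal_congr_of_null μ0 _ _ Z hZ0 ?_
      ext ω
      simp only [mem_inter_iff, mem_empty_iff_false, false_and, iff_false, not_and]
      intro hωW hω
      apply hW
      rw [mem_clusterIs] at hωW
      ext z
      simp only [Finset.mem_singleton]
      constructor
      · intro hz
        have hz' : z ∈ openCluster ω o := by rw [hωW]; exact Finset.mem_coe.2 hz
        exact eq_of_reachable_of_isolated hω hz'
      · rintro rfl
        have : z ∈ openCluster ω z := mem_openCluster_self ω z
        rw [hωW] at this
        exact Finset.mem_coe.1 this
    rw [h, measureReal_empty]
  have hcl1 : μ0.real (clusterIs o ({o} : Finset (Fin n))) = 1 := by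
    have h : μ0.real (clusterIs o ({o} : Finset (Fin n))) = μ0.real (univ : Set (BondConfig (Fin n))) := by
      refine measureReal_congr_of_null μ0 _ _ Z hZ0 ?_
      ext ω
      simp only [mem_inter_iff, mem_univ, true_and]
      constructor
      · exact fun h => h.2
      · intro hω
        refine ⟨?_, hω⟩
        rw [mem_clusterIs, Finset.coe_singleton]
        ext z
        simp only [mem_singleton_iff]
        exact ⟨fun hz => eq_of_reachable_of_isolated hω hz, fun hz => hz ▸ mem_openCluster_self ω z⟩
    rw [h, probReal_univ]
  have hmem : ({o} : Finset (Fin n)) ∈ nullSets A := by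
    rw [mem_nullSets, Finset.disjoint_singleton_left]; exact ho
  rw [Finset.sum_eq_single_of_mem _ hmem (fun W hW hne => by rw [hcl W hW hne, zero_mul]), hcl1, one_mul, hob, zero_sub]
  have hinf : A.inf' hA (fun a' => μ0.real (openConnIn ((↑({o} : Finset (Fin n)) : Set (Fin n))ᶜ) a' b)) =
      A.inf' hA (fun a' => μ0.real (openConn a' b)) := by
    refine Finset.inf'_congr hA rfl fun a' ha' => ?_
    rw [hμ0]
    exact real_openConnIn_compl_singleton_wzero w o a' b (fun h => ho (h ▸ ha'))
  rw [hinf]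
  ring

end KNGoodSeries

end Summit.CriticalPhenomena.PercolationContinuityZ3.Theorems

end
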